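import Literature.NumberTheory.PAdicHodge.DeRhamOfTatePtPeriods
import Literature.NumberTheory.PAdicHodge.AinfWeierstrassTateModuleGeomO
import HarnessLib

/-!
# `V_pE` is de Rham for a good `𝒪_F`-MODEL with supersingular reduction, from two period homomorphisms on `T_pŴ(𝒪_{ℂ_F})`
# (the socket of the ramified road (R1); proofs only)

Topic `Literature/NumberTheory/PAdicHodge`; namespace `Literature.NumberTheory.PAdicHodge`. THEOREMS ONLY (no definition, no named
fact, no instance, no `sorry`). The `𝒪_F`-coefficient twin of `DeRhamOfTatePtPeriods` §2 (case `W/ℤ`): for a Weierstrass equation `W`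
over the discrete copy `LTCoeff F` of `𝒪_F` with GOOD SUPERSINGULAR reduction (`Δ_W ∈ 𝒪_F^×`, `A_p(W mod 𝔪_F) = 0`, `p` odd = residue
characteristic) — the situation of an elliptic curve with additive, potentially supersingular reduction after passage to the ramified field
over which good reduction is attained (K★'s cells (5; IV*), (5; II*), (7; III*) of BSD route EdixhovenFibreFiveSeven) — the criterion
`isDeRham_rationalTateRep_of_periodHoms` (file `DeRhamOfPeriodHoms`, coefficient-free) is fed through

* the matching `AinfTop.tateGeomEquivTatePtOSS : T_p E(F̄) ≃ₗ[ℤ_p] TatePtO F W p = T_pŴ(𝒪_{ℂ_F})` (unconditional at good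
  supersingular reduction, `Γ_F`-equivariant; file `AinfWeierstrassTateModuleGeomO`), and
* the embedding `B_dR⁺(F) ⊆ B_dR(F)` (`DeRhamOfTatePtPeriods.algebraMap_mem_fil_one_iff`, `smul_algebraMap_fracBdR`,
  `embBdRHom_algebraMap_padic`),

with the two periods left ABSTRACT: any two additive maps `φ₁, φ₂ : T_pŴ(𝒪_{ℂ_F}) → B_dR⁺(F)` which are `ℤ_p`-homogeneous,
`Γ_F`-equivariant, with `φ₁ ∈ Fil¹`, `φ₁ ≢ 0`, `φ₂ ∉ Fil¹` somewhere. Result: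

* **`isDeRham_rationalTateRep_curveFO_of_periodHoms`** — `GaloisRep.IsDeRham (bdRPeriodRingData hp) (rationalTateRep (curveFO F W) p)`;
* **`isDeRham_restrictedRationalTateRep_of_periodHomsO`** — the same for any `W₀/K₀`, `K₀ ⊆ F`, with `W₀ ×_{K₀} F = W ⊗_{𝒪_F} F`,
  in the currency `restrictedRationalTateRep` of the cite-only fact `isDeRham_restrictedRationalTateRep`.

Intended instances of `φ₁, φ₂`: the ω- and η-periods over the ramified Fontaine ring `A_inf(𝒪) = 𝔸_inf(F)[ϖ]` read on `TatePtO`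
(`AinfRamTop.omegaPeriodO`, file `AinfRamifiedTateModule`; additivity / `ℤ_p`-linearity / η: files `AinfRamifiedOmegaPeriodAdd`,
`AinfRamifiedPeriodsBounded`, `AinfRamifiedEtaPeriod*`). BSD / K★ (`stmt-BirchSwinnertonDyer-22226`) are not proved by any of this; the
cite-only fact `isDeRham_restrictedRationalTateRep` stays cite-only.

## References
* [Fontaine1982FormesDifferentielles] J.-M. Fontaine, Invent. Math. 65 (1982), §5.
* [Colmez1992PeriodesAbeliennes] P. Colmez, Math. Ann. 292 (1992), §2.
* [FontaineAsterisque223III] J.-M. Fontaine, Astérisque 223 (1994), Exp. II §1.5, Exp. III §1.5.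
* [Tate1967] J. Tate, *p-divisible groups* (1967), §4.
-/

noncomputable section

open scoped TensorProduct

namespace Literature.NumberTheory.PAdicHodge

open Literature Literature.NumberTheory.GaloisRepresentations Literature.NumberTheory.EllipticCurves WeierstrassCurve
open Literature.NumberTheory.GaloisRepresentations.IsNonarchimedeanLocalField Field ValuativeRel
open Literature.NumberTheory.GaloisRepresentations.LubinTate

variable {F : Type} [Field F] [ValuativeRel F] [TopologicalSpace F] [IsNonarchimedeanLocalField F] [CharZero F]
  {p : ℕ} [Fact p.Prime] [Fact (¬ IsUnit (p : integerC F))] [IsAdicComplete (Ideal.span {(p : integerC F)}) (integerC F)]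
  (hp : valuation F p < 1) [Algebra ℚ_[p] F] [CharP 𝓀[F] p]

/-- **hDR for a good `𝒪_F`-model with supersingular reduction, from two abstract period homomorphisms on `T_pŴ(𝒪_{ℂ_F})`.**
Let `W` be a Weierstrass equation over `𝒪_F` (`LTCoeff F`) with `Δ_W ∈ 𝒪_F^×` and supersingular reduction at the odd residue
characteristic `p`, `E = curveFO F W = W ⊗ F`, and `F` carry ANY `ℚ_p`-algebra structure (it is the canonical one, tree
`LocalField.ringHom_padic_ext`). If `φ₁, φ₂ : TatePtO F W p →+ B_dR⁺(F)` are `ℤ_p`-homogeneous (`φ (a·τ) = ι(a)·φ τ`) and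
`Γ_F`-equivariant (`σ(φ τ) = φ(σ·τ)`), `φ₁` takes values in `Fil¹`, `φ₁ τ ≠ 0` for some `τ` and `φ₂ τ ∉ Fil¹` for some `τ`, then
`V_pE` is de Rham for Fontaine's `bdRPeriodRingData hp`: the maps `φᵢ ∘ e` (`e = tateGeomEquivTatePtOSS : T_pE ≃ T_pŴ(𝒪_{ℂ_F})`)
read in `B_dR ⊇ B_dR⁺` satisfy the hypotheses of `isDeRham_rationalTateRep_of_periodHoms`. BSD is not proved by this.
[cite: Fontaine1982FormesDifferentielles, §5] [cite: Colmez1992PeriodesAbeliennes, §2] [cite: Tate1967, §4] -/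
theorem isDeRham_rationalTateRep_curveFO_of_periodHoms (W : WeierstrassCurve (LTCoeff F)) [(AinfTop.curveFO F W).IsElliptic]
    (hp2 : p ≠ 2) (hΔ : IsUnit W.Δ) (hA : (W.map (AinfTop.redCoeff F)).hasseCoeff p = 0)
    (φ₁ φ₂ : AinfTop.TatePtO F W p →+ BdRPlusTop F p)
    (hφ₁s : ∀ (a : ℤ_[p]) (τ : AinfTop.TatePtO F W p), φ₁ (a • τ) = BdRPlusTop.of F p (qpToBdR (a : ℚ_[p])) * φ₁ τ)
    (hφ₂s : ∀ (a : ℤ_[p]) (τ : AinfTop.TatePtO F W p), φ₂ (a • τ) = BdRPlusTop.of F p (qpToBdR (a : ℚ_[p])) * φ₂ τ)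
    (hφ₁g : ∀ (σ : absoluteGaloisGroup F) (τ : AinfTop.TatePtO F W p), BdRPlusTop.gal F p σ (φ₁ τ) = φ₁ (σ • τ))
    (hφ₂g : ∀ (σ : absoluteGaloisGroup F) (τ : AinfTop.TatePtO F W p), BdRPlusTop.gal F p σ (φ₂ τ) = φ₂ (σ • τ))
    (hφ₁f : ∀ τ : AinfTop.TatePtO F W p, φ₁ τ ∈ (BdRPlusTop.filOne F p).toIdeal)
    (hN1 : ∃ τ : AinfTop.TatePtO F W p, φ₁ τ ≠ 0)
    (hNη : ∃ τ : AinfTop.TatePtO F W p, φ₂ τ ∉ (BdRPlusTop.filOne F p).toIdeal) :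
    GaloisRep.IsDeRham (bdRPeriodRingData (F := F) (p := p) hp) (rationalTateRep (AinfTop.curveFO F W) p) := by
  have hF := surjective_fontaineTheta_integerC hp
  -- rigidity: the `ℚ_p`-algebra structure of `F` is the canonical one (tree `LocalField.ringHom_padic_ext`)
  have halg : ∀ c : ℚ_[p], algebraMap ℚ_[p] F c = LocalField.padicRingHom F p hp c := fun c =>
    RingHom.congr_fun (LocalField.ringHom_padic_ext _ _) c
  -- the matching, the embedding `B_dR⁺ → B_dR`, and the two period functionals on `T_pE`
  let e : (AinfTop.curveFO F W).tateModule p ≃ₗ[ℤ_[p]] AinfTop.TatePtO F W p :=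
    AinfTop.tateGeomEquivTatePtOSS F W p hp2 hΔ hA
  let ιB : BdRPlusTop F p →+* (bdRPeriodRingData (F := F) (p := p) hp).B :=
    (algebraMap (BDeRhamPlus (integerC F) p) (FracBdR F p)).comp (BdRPlusTop.of F p).symm.toRingHom
  have hιB : ∀ y, ιB y = algebraMap (BDeRhamPlus (integerC F) p) (FracBdR F p) ((BdRPlusTop.of F p).symm y) :=
    fun _ => rfl
  let ψ₁ : (AinfTop.curveFO F W).tateModule p →+ (bdRPeriodRingData (F := F) (p := p) hp).B :=
    ιB.toAddMonoidHom.comp (φ₁.comp e.toAddMonoidHom)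
  let ψ₂ : (AinfTop.curveFO F W).tateModule p →+ (bdRPeriodRingData (F := F) (p := p) hp).B :=
    ιB.toAddMonoidHom.comp (φ₂.comp e.toAddMonoidHom)
  have hψ₁ : ∀ a, ψ₁ a = ιB (φ₁ (e a)) := fun _ => rfl
  have hψ₂ : ∀ a, ψ₂ a = ιB (φ₂ (e a)) := fun _ => rfl
  -- dictionary: scalars, Galois, the matching
  have hsc : ∀ (c : ℤ_[p]) (y : BdRPlusTop F p),
      ιB (BdRPlusTop.of F p (qpToBdR (c : ℚ_[p])) * y) = (c : ℚ_[p]) • ιB y := fun c y => by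
    rw [map_mul, Algebra.smul_def, PeriodRingData.algebraMap_eq]
    congr 1
    change algebraMap (BDeRhamPlus (integerC F) p) (FracBdR F p) (qpToBdR (c : ℚ_[p])) =
      algebraMap (BDeRhamPlus (integerC F) p) (FracBdR F p) (embBdRHom hp hF (algebraMap ℚ_[p] F c))
    rw [embBdRHom_algebraMap_padic hp hF halg]
  have hgal : ∀ (σ : absoluteGaloisGroup F) (y : BdRPlusTop F p), ιB (BdRPlusTop.gal F p σ y) = σ • ιB y := fun σ y => by
    change _ = σ • algebraMap (BDeRhamPlus (integerC F) p) (FracBdR F p) ((BdRPlusTop.of F p).symm y)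
    rw [smul_algebraMap_fracBdR]
    rfl
  have he : ∀ (σ : absoluteGaloisGroup F) (a : (AinfTop.curveFO F W).tateModule p), e (σ • a) = σ • e a := fun σ a =>
    AinfTop.tateGeomEquivTatePtOSS_smul W hp2 hΔ hA σ a
  -- feed the criterion
  refine isDeRham_rationalTateRep_of_periodHoms hp (AinfTop.curveFO F W) ψ₁ ψ₂ (fun c a => ?_) (fun c a => ?_)
    (fun σ a => ?_) (fun σ a => ?_) (fun a => ?_) ?_ ?_
  · rw [hψ₁, hψ₁, LinearEquiv.map_smul, hφ₁s, hsc]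
  · rw [hψ₂, hψ₂, LinearEquiv.map_smul, hφ₂s, hsc]
  · rw [hψ₁, hψ₁, he, ← hφ₁g, hgal]
  · rw [hψ₂, hψ₂, he, ← hφ₂g, hgal]
  · rw [hψ₁, hιB]
    exact (algebraMap_mem_fil_one_iff hp _).2 (hφ₁f _)
  · obtain ⟨τ, hτ⟩ := hN1
    refine ⟨e.symm τ, fun h0 => hτ ?_⟩
    rw [hψ₁, LinearEquiv.apply_symm_apply, hιB] at h0
    have h1 := algebraMap_fracBdR_injective (F := F) (p := p) (h0.trans (map_zero _).symm)
    exact (BdRPlusTop.of F p).symm.injective (h1.trans (map_zero _).symm)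
  · obtain ⟨τ, hτ⟩ := hNη
    refine ⟨e.symm τ, fun h => hτ ((algebraMap_mem_fil_one_iff hp (φ₂ τ)).1 ?_)⟩
    rwa [hψ₂, LinearEquiv.apply_symm_apply, hιB] at h

/-- **hDR for a curve over a subfield `K₀ ⊆ F` whose base change to `F` is `W ⊗_{𝒪_F} F`** (`W` a good `𝒪_F`-model with supersingular
reduction at the odd residue characteristic `p`), in the literal currency `restrictedRationalTateRep` of the cite-only fact
`isDeRham_restrictedRationalTateRep`, from two abstract period homomorphisms on `T_pŴ(𝒪_{ℂ_F})`:
`isDeRham_rationalTateRep_curveFO_of_periodHoms` transported along the tree's `isDeRham_restrictedRationalTateRep_iff_baseChange`.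
(E.g. `K₀ = ℚ`, `F` the completion of `ℚ(p^{1/e})` at the prime over `p`, `W` the good model of a curve with additive potentially
supersingular reduction.) BSD is not proved by this. [cite: Fontaine1982FormesDifferentielles, §5] [cite: Colmez1992PeriodesAbeliennes, §2] -/
theorem isDeRham_restrictedRationalTateRep_of_periodHomsO {K₀ : Type} [Field K₀] [CharZero K₀] [Algebra K₀ F]
    (W₀ : WeierstrassCurve K₀) [W₀.IsElliptic] (W : WeierstrassCurve (LTCoeff F)) (hW : W₀.baseChange F = AinfTop.curveFO F W)
    (hp2 : p ≠ 2) (hΔ : IsUnit W.Δ) (hA : (W.map (AinfTop.redCoeff F)).hasseCoeff p = 0)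
    (φ₁ φ₂ : AinfTop.TatePtO F W p →+ BdRPlusTop F p)
    (hφ₁s : ∀ (a : ℤ_[p]) (τ : AinfTop.TatePtO F W p), φ₁ (a • τ) = BdRPlusTop.of F p (qpToBdR (a : ℚ_[p])) * φ₁ τ)
    (hφ₂s : ∀ (a : ℤ_[p]) (τ : AinfTop.TatePtO F W p), φ₂ (a • τ) = BdRPlusTop.of F p (qpToBdR (a : ℚ_[p])) * φ₂ τ)
    (hφ₁g : ∀ (σ : absoluteGaloisGroup F) (τ : AinfTop.TatePtO F W p), BdRPlusTop.gal F p σ (φ₁ τ) = φ₁ (σ • τ))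
    (hφ₂g : ∀ (σ : absoluteGaloisGroup F) (τ : AinfTop.TatePtO F W p), BdRPlusTop.gal F p σ (φ₂ τ) = φ₂ (σ • τ))
    (hφ₁f : ∀ τ : AinfTop.TatePtO F W p, φ₁ τ ∈ (BdRPlusTop.filOne F p).toIdeal)
    (hN1 : ∃ τ : AinfTop.TatePtO F W p, φ₁ τ ≠ 0)
    (hNη : ∃ τ : AinfTop.TatePtO F W p, φ₂ τ ∉ (BdRPlusTop.filOne F p).toIdeal) :
    GaloisRep.IsDeRham (bdRPeriodRingData (F := F) (p := p) hp) (restrictedRationalTateRep W₀ F p) := by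
  rw [isDeRham_restrictedRationalTateRep_iff_baseChange hp W₀]
  have key : ∀ (E : WeierstrassCurve F) [E.IsElliptic], E = AinfTop.curveFO F W →
      GaloisRep.IsDeRham (bdRPeriodRingData (F := F) (p := p) hp) (rationalTateRep E p) := by
    intro E _ hE
    subst hE
    exact isDeRham_rationalTateRep_curveFO_of_periodHoms hp W hp2 hΔ hA φ₁ φ₂ hφ₁s hφ₂s hφ₁g hφ₂g hφ₁f hN1 hNη
  exact key _ hW

end Literature.NumberTheory.PAdicHodge

end
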